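import Mathlib
import Summits.Ventures.HodgeRepro2.Tier7.Line3.DiscreteCoverLift

/-!
# Tier 7 — LINE 3 support: ARCHIMEDEAN DISCRETENESS OF THE INTEGRAL POINTS — `1` is isolated in the image of any
subgroup of `GL₂(E)` that is integral (in a basis `P`) in the product of the archimedean `GL₂`'s
(`Line3/ArchimedeanDiscrete.lean`; t7-L1-p1, gen 6; Mathlib + Line3/DiscreteCoverLift)

`DiscreteCoverLift.continuous_kernelSum_K₃_of_comap_three` and `ArchimedeanCover.continuous_kernelSum_H₃` take the real
lattice as a subgroup `Γ` of the real archimedean group with `1` ISOLATED (`IsolatedOne Γ`), and the record lists that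
isolation — the discreteness of the real `Γ_N` — among the clauses in words (plan-3 l. 16114 (3); lead l. 16047). THIS FILE
makes it a theorem of the MODEL: the image of the ring of integers of a number field `E` in the mixed space
`E ⊗ ℝ = ∏_{w real} ℝ × ∏_{w complex} ℂ` is a discrete lattice (Mathlib: `DiscreteTopology (mixedEmbedding.integerLattice E)`).
* §1 `exists_isolating_open E`: an open `U ∋ 0` of the mixed space meeting the image of `𝓞 E` only at `0` (the singleton
  `{0}` of the lattice is open in the subtype topology, `IsInducing.subtypeVal.isOpen_iff`; `mixedEmbedding_injective`).
  For a TOTALLY COMPLEX `E` (`htc : ∀ w, w.IsComplex` — a DISPLAYED datum, true for the CM field `E′` of the sentence) the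
  real places' index type is EMPTY, so the real factor of the mixed space is a function on an empty type and
  `mixedSpace E ≃ₜ ∏_{w complex} ℂ`; `compEmb E := RingHom.pi fun w => w.embedding` is the complex coordinates of
  `mixedEmbedding` (`mixedEmbedding_eq`), and `exists_isolating_open_complex` is §1 read through that identification
  (the isolating open set is the preimage of `U`). `{w // w.IsComplex}` is non-empty (a number field has an infinite
  place) — nothing is vacuous.
* §2 the INTEGRAL matrices `IntegralEntries E M := ∀ i j, ∃ y : 𝓞 E, algebraMap (𝓞 E) E y = M i j` (closed under `1`
  and products), the integral subgroup `integralGL E = {g | IntegralEntries ↑g ∧ IntegralEntries ↑g⁻¹}` (= `GL₂(𝓞_E)`;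
  not trivial: `neg_one_mem_integralGL`), and the archimedean embedding
  `archEmb E : GL (Fin 2) E →* ((w : {w // w.IsComplex}) → GL (Fin 2) ℂ)` = `MonoidHom.pi fun w => GeneralLinearGroup.map
  w.embedding`. TOPOLOGIES: `Pi.topologicalSpace` of the `Units` topology on each `GL (Fin 2) ℂ` — the same `GL₂(ℂ)` as
  ArchimedeanCover's, so that the transfer of §4 composes with the inclusion `H₃ = U(2) × U(1,1)² ↪ ∏_{w|∞} GL₂(ℂ)`
  (`U(2) ⊂ GL₂(ℂ)` at `ι₁`, `U(1,1) ⊂ GL₂(ℂ)` at `ι₂, ι₃`; the CM field `E′` of degree 6 has exactly three complex places).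
* §3 THE THEOREM `isolatedOne_map_of_integral htc Γ hΓ : IsolatedOne (Γ.map (archEmb E))` for every `Γ ≤ GL (Fin 2) E`
  with integral entries: the open set `V = {h | ∀ i j, (fun w => ↑(h w) i j − (1 : Matrix) i j) ∈ U}` (continuity into the
  Pi type: `Units.continuous_val`, `continuous_apply`, `Continuous.matrix_elem`; a finite intersection over `i j`)
  contains `1` and meets the IMAGE `Γ.map (archEmb E)` only at `1` — for `g ∈ Γ` the entry `g i j − δ_ij ∈ 𝓞 E` has
  `compEmb` in `U`, so it is `0`, so `g = 1` (`Units.ext`, `Matrix.ext`); its instance `isolatedOne_integralGL`; and, through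
  the abstract `isolatedOne_map_of_isolating` (any ring hom `φ : E →+* R` into a topological ring whose restriction to
  `𝓞 E` has `0` isolated), the general-field form `isolatedOne_map_mixed` — over `GL (Fin 2) (mixedSpace E)`, the units
  of the matrix ring over the PRODUCT RING `mixedSpace E` with its product topology (not a field), any number field `E`,
  `[NumberField E]` only, no `htc`.
* §4 helpers on `IsolatedOne`: `isolatedOne_of_le` (every subgroup inherits — the level subgroups `Γ_N ≤ Γ_1` at once),
  the TRANSFER `isolatedOne_of_map` through a continuous injective hom `ι : H' →* H` (`1` isolated in `ι(Γ')` gives `1`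
  isolated in `Γ'` — how «`1` isolated in the real `Γ_N ≤ H₃`» follows once `H₃ ↪ ∏_w GL₂(ℂ)` is the identification),
  and `isolatedOne_map_equiv` (an isomorphism with continuous inverse carries isolation forward).
* §5 THE LATTICE-BASIS FORM `isolatedOne_map_of_integral_conj htc Γ P hΓ` with `hΓ : ∀ g ∈ Γ, IntegralEntries (P⁻¹ g P)`
  — «integral in the basis `P`», exactly L1-p4's lattice datum `hPint` (crit-2 l. 16162 (i)): §3 on the conjugate
  subgroup `P⁻¹ Γ P`, carried back by conjugation with `archEmb E P` (continuous, injective).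

WHAT STAYS IN WORDS (the dictionary, (a′)): that the real `Γ_N` is a subgroup of `GL₂(E′)` integral in the lattice
basis `f` (= `P`; the datum sentence `hPint`), that `E′` is totally complex (CM: a datum sentence), and that the inclusion
`H₃ ↪ ∏_{w|∞} GL₂(ℂ)` IS the identification of the real archimedean groups (which hermitian form, which basis); `Γ = ⊥` is
the trivial instance, the content is `Γ = integralGL E` and its conjugates / level subgroups. Nothing about (N), (P), the
real X or HC_CM; [M]-level consolidation of the [W] column (the «`1` isolated» clause of l. 16114 (3) / the M4 line becomes
a theorem of the model + the dictionary); NOT distance to (P); the residual (a′)/(b′) is unchanged in kind; LEMMAS CLOSING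
THE STEP: 0. Sorry-free; axioms: propext / Classical.choice / Quot.sound. §8(d): uses an L-value-free device: NO.
-/

namespace Summit.Ventures.HodgeRepro2.Tier7.Line3.ArchimedeanDiscrete

open NumberField Topology
open Summit.Ventures.HodgeRepro2.Tier7.Line3.DiscreteCoverLift (IsolatedOne)
open scoped MatrixGroups

noncomputable section

variable (E : Type) [Field E] [NumberField E]

/-! ## 1. `0` is isolated in the image of `𝓞 E` in the mixed space, and in `∏_{w complex} ℂ` for a totally complex `E` -/

/-- **the integer lattice is discrete** (Mathlib's `DiscreteTopology (mixedEmbedding.integerLattice E)`): an open set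
`U ∋ 0` of the mixed space meets the image of `𝓞 E` only at `0`. -/
theorem exists_isolating_open :
    ∃ U : Set (mixedEmbedding.mixedSpace E), IsOpen U ∧ (0 : mixedEmbedding.mixedSpace E) ∈ U ∧
      ∀ y : 𝓞 E, mixedEmbedding E (algebraMap (𝓞 E) E y) ∈ U → y = 0 := by
  have h0 : IsOpen ({⟨0, Submodule.zero_mem _⟩} : Set (mixedEmbedding.integerLattice E)) :=
    isOpen_discrete _
  obtain ⟨U, hU, hUeq⟩ := IsInducing.subtypeVal.isOpen_iff.1 h0
  refine ⟨U, hU, ?_, ?_⟩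
  · exact (Set.ext_iff.1 hUeq ⟨0, Submodule.zero_mem _⟩).2 (Set.mem_singleton _)
  · intro y hy
    have hmem : mixedEmbedding E (algebraMap (𝓞 E) E y) ∈ mixedEmbedding.integerLattice E :=
      LinearMap.mem_range.2 ⟨y, rfl⟩
    have h1 : (⟨_, hmem⟩ : mixedEmbedding.integerLattice E) = ⟨0, Submodule.zero_mem _⟩ :=
      Set.mem_singleton_iff.1 ((Set.ext_iff.1 hUeq ⟨_, hmem⟩).1 hy)
    have h2 : mixedEmbedding E (algebraMap (𝓞 E) E y) = 0 := congrArg Subtype.val h1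
    have h3 : algebraMap (𝓞 E) E y = 0 := mixedEmbedding_injective E (by rw [h2, map_zero])
    exact RingOfIntegers.coe_injective (by rw [h3, map_zero])

/-- the archimedean embedding of `E` into the product of its complex places -/
def compEmb : E →+* ((w : {w : InfinitePlace E // w.IsComplex}) → ℂ) :=
  RingHom.pi fun w => w.1.embedding

omit [NumberField E] in
/-- the `w`-coordinate of `compEmb E x` is `w.embedding x` -/
theorem compEmb_apply (x : E) (w : {w : InfinitePlace E // w.IsComplex}) :
    compEmb E x w = w.1.embedding x := rfl

omit [NumberField E] in
/-- for a totally complex `E` the mixed embedding is `compEmb` in the complex factor (the real factor is a function on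
an empty type) -/
theorem mixedEmbedding_eq (htc : ∀ w : InfinitePlace E, w.IsComplex) (x : E) :
    mixedEmbedding E x =
      (fun w : {w : InfinitePlace E // w.IsReal} =>
        (absurd w.2 (InfinitePlace.not_isReal_iff_isComplex.2 (htc w.1)) : ℝ), compEmb E x) := by
  refine Prod.ext ?_ ?_
  · funext w
    exact absurd w.2 (InfinitePlace.not_isReal_iff_isComplex.2 (htc w.1))
  · funext w
    exact mixedEmbedding.mixedEmbedding_apply_isComplex E x w

/-- **`0` is isolated in the image of `𝓞 E` in `∏_{w complex} ℂ`** for a totally complex `E`. -/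
theorem exists_isolating_open_complex (htc : ∀ w : InfinitePlace E, w.IsComplex) :
    ∃ U : Set ((w : {w : InfinitePlace E // w.IsComplex}) → ℂ), IsOpen U ∧
      (0 : (w : {w : InfinitePlace E // w.IsComplex}) → ℂ) ∈ U ∧
      ∀ y : 𝓞 E, compEmb E (algebraMap (𝓞 E) E y) ∈ U → y = 0 := by
  obtain ⟨U, hU, h0, hiso⟩ := exists_isolating_open E
  let ι : ((w : {w : InfinitePlace E // w.IsComplex}) → ℂ) → mixedEmbedding.mixedSpace E :=
    fun x => (fun w => absurd w.2 (InfinitePlace.not_isReal_iff_isComplex.2 (htc w.1)), x)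
  have hι : Continuous ι := continuous_const.prodMk continuous_id
  refine ⟨ι ⁻¹' U, hU.preimage hι, ?_, ?_⟩
  · show ι 0 ∈ U
    have h : ι 0 = 0 := by
      refine Prod.ext ?_ rfl
      funext w
      exact absurd w.2 (InfinitePlace.not_isReal_iff_isComplex.2 (htc w.1))
    rw [h]
    exact h0
  · intro y hy
    apply hiso y
    rw [mixedEmbedding_eq E htc]
    exact hy

/-! ## 2. Integral matrices, the integral subgroup `GL₂(𝓞_E)`, the archimedean embedding of `GL₂(E)` -/

/-- every entry of `M` lies in `𝓞 E` -/
def IntegralEntries (M : Matrix (Fin 2) (Fin 2) E) : Prop :=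
  ∀ i j, ∃ y : 𝓞 E, algebraMap (𝓞 E) E y = M i j

omit [NumberField E] in
/-- the identity matrix is integral -/
theorem integralEntries_one : IntegralEntries E (1 : Matrix (Fin 2) (Fin 2) E) := by
  intro i j
  by_cases h : i = j
  · subst h
    exact ⟨1, by simp⟩
  · exact ⟨0, by simp [Matrix.one_apply_ne h]⟩

omit [NumberField E] in
/-- products of integral matrices are integral -/
theorem integralEntries_mul {M N : Matrix (Fin 2) (Fin 2) E} (hM : IntegralEntries E M)
    (hN : IntegralEntries E N) : IntegralEntries E (M * N) := by
  intro i j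
  choose a ha using hM
  choose b hb using hN
  refine ⟨∑ k, a i k * b k j, ?_⟩
  simp [Matrix.mul_apply, map_mul, ha, hb]

/-- **`GL₂(𝓞_E)`**: the units of `M₂(E)` with integral entries and integral inverse -/
def integralGL : Subgroup (GL (Fin 2) E) where
  carrier := {g | IntegralEntries E (g : Matrix (Fin 2) (Fin 2) E) ∧
    IntegralEntries E ((g⁻¹ : GL (Fin 2) E) : Matrix (Fin 2) (Fin 2) E)}
  one_mem' := ⟨integralEntries_one E, by simpa using integralEntries_one E⟩
  mul_mem' := by
    rintro a b ⟨ha1, ha2⟩ ⟨hb1, hb2⟩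
    refine ⟨?_, ?_⟩
    · rw [Units.val_mul]
      exact integralEntries_mul E ha1 hb1
    · rw [mul_inv_rev, Units.val_mul]
      exact integralEntries_mul E hb2 ha2
  inv_mem' := by
    rintro a ⟨ha1, ha2⟩
    exact ⟨ha2, by rw [inv_inv]; exact ha1⟩

omit [NumberField E] in
/-- the elements of `integralGL E` have integral entries -/
theorem integralEntries_of_mem_integralGL {g : GL (Fin 2) E} (hg : g ∈ integralGL E) :
    IntegralEntries E (g : Matrix (Fin 2) (Fin 2) E) := hg.1

omit [NumberField E] in
/-- `-1 ∈ GL₂(𝓞_E)` (non-vacuity: the integral subgroup is not trivial) -/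
theorem neg_one_mem_integralGL : (-1 : GL (Fin 2) E) ∈ integralGL E := by
  have h : IntegralEntries E ((-1 : GL (Fin 2) E) : Matrix (Fin 2) (Fin 2) E) := by
    intro i j
    by_cases hij : i = j
    · subst hij
      exact ⟨-1, by simp⟩
    · exact ⟨0, by simp [Matrix.one_apply_ne hij]⟩
  refine ⟨h, ?_⟩
  have h2 : (-1 : GL (Fin 2) E)⁻¹ = -1 := by
    rw [inv_eq_iff_mul_eq_one]
    exact Units.ext (by simp)
  rw [h2]
  exact h

/-- **the archimedean embedding of `GL₂(E)`** into the product of the `GL₂(ℂ)` at the complex places -/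
def archEmb : GL (Fin 2) E →* ((w : {w : InfinitePlace E // w.IsComplex}) → GL (Fin 2) ℂ) :=
  MonoidHom.pi fun w => Matrix.GeneralLinearGroup.map w.1.embedding

omit [NumberField E] in
/-- the `(i, j)` entry of the `w`-component of `archEmb E g` is `w.embedding (g i j)` -/
theorem archEmb_apply_entry (g : GL (Fin 2) E) (w : {w : InfinitePlace E // w.IsComplex}) (i j : Fin 2) :
    ((archEmb E g w : GL (Fin 2) ℂ) : Matrix (Fin 2) (Fin 2) ℂ) i j =
      w.1.embedding ((g : Matrix (Fin 2) (Fin 2) E) i j) :=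
  Matrix.GeneralLinearGroup.map_apply _ i j g

omit [NumberField E] in
/-- the image of the identity matrix under a ring hom, entrywise -/
theorem map_one_apply {R : Type} [CommRing R] (φ : E →+* R) (i j : Fin 2) :
    φ ((1 : Matrix (Fin 2) (Fin 2) E) i j) = (1 : Matrix (Fin 2) (Fin 2) R) i j := by
  by_cases h : i = j
  · subst h
    simp
  · simp [Matrix.one_apply_ne h]

/-! ## 3. THE THEOREM: `1` is isolated in the image of an integral subgroup at the archimedean places -/

/-- **`1` is isolated in the archimedean image of every subgroup of `GL₂(E)` with integral entries** (`E` totally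
complex): the `IsolatedOne Γ` binder of the consumers, as a theorem of the model. -/
theorem isolatedOne_map_of_integral (htc : ∀ w : InfinitePlace E, w.IsComplex) (Γ : Subgroup (GL (Fin 2) E))
    (hΓ : ∀ g ∈ Γ, IntegralEntries E (g : Matrix (Fin 2) (Fin 2) E)) : IsolatedOne (Γ.map (archEmb E)) := by
  obtain ⟨U, hU, h0, hiso⟩ := exists_isolating_open_complex E htc
  let V : Set ((w : {w : InfinitePlace E // w.IsComplex}) → GL (Fin 2) ℂ) :=
    ⋂ i : Fin 2, ⋂ j : Fin 2, {h | (fun w => ((h w : GL (Fin 2) ℂ) : Matrix (Fin 2) (Fin 2) ℂ) i j -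
      (1 : Matrix (Fin 2) (Fin 2) ℂ) i j) ∈ U}
  have hVopen : IsOpen V := by
    refine isOpen_iInter_of_finite fun i => isOpen_iInter_of_finite fun j => hU.preimage ?_
    refine continuous_pi fun w => ?_
    exact ((Units.continuous_val.comp (continuous_apply w)).matrix_elem i j).sub continuous_const
  have h1V : (1 : (w : {w : InfinitePlace E // w.IsComplex}) → GL (Fin 2) ℂ) ∈ V := by
    simp only [V, Set.mem_iInter, Set.mem_setOf_eq]
    intro i j
    have h : (fun w : {w : InfinitePlace E // w.IsComplex} =>
        (((1 : (w : {w : InfinitePlace E // w.IsComplex}) → GL (Fin 2) ℂ) w : GL (Fin 2) ℂ) :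
          Matrix (Fin 2) (Fin 2) ℂ) i j - (1 : Matrix (Fin 2) (Fin 2) ℂ) i j) = 0 := by
      funext w
      simp
    rw [h]
    exact h0
  refine ⟨V, hVopen.mem_nhds h1V, ?_⟩
  rintro γ ⟨g, hg, rfl⟩ hγV
  have hentry : ∀ i j, (g : Matrix (Fin 2) (Fin 2) E) i j = (1 : Matrix (Fin 2) (Fin 2) E) i j := by
    intro i j
    obtain ⟨y, hy⟩ := hΓ g hg i j
    obtain ⟨d, hd⟩ := integralEntries_one E i j
    have hmem : compEmb E (algebraMap (𝓞 E) E (y - d)) ∈ U := by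
      have h := Set.mem_iInter.1 (Set.mem_iInter.1 hγV i) j
      simp only [Set.mem_setOf_eq] at h
      convert h using 1
      funext w
      rw [compEmb_apply, map_sub, map_sub, hy, hd, archEmb_apply_entry, map_one_apply]
    have h1 := hiso _ hmem
    have h2 : algebraMap (𝓞 E) E y = algebraMap (𝓞 E) E d := by
      have h3 := congrArg (algebraMap (𝓞 E) E) h1
      rwa [map_sub, map_zero, sub_eq_zero] at h3
    rw [← hy, ← hd, h2]
  have hg1 : g = 1 := Units.ext (Matrix.ext hentry)
  rw [hg1, map_one]

/-- **`1` is isolated in the archimedean image of `GL₂(𝓞_E)`** (`E` totally complex). -/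
theorem isolatedOne_integralGL (htc : ∀ w : InfinitePlace E, w.IsComplex) :
    IsolatedOne ((integralGL E).map (archEmb E)) :=
  isolatedOne_map_of_integral E htc _ fun _ hg => integralEntries_of_mem_integralGL E hg

omit [NumberField E] in
/-- the abstract form: a ring hom `φ : E →+* R` into a topological ring whose restriction to `𝓞 E` has `0` isolated
(an open `U ∋ 0` with `φ (𝓞 E) ∩ U = {0}`) makes `1` isolated in the image of every integral subgroup of `GL₂(E)`
in `GL₂(R)` -/
theorem isolatedOne_map_of_isolating {R : Type} [CommRing R] [TopologicalSpace R] [IsTopologicalRing R]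
    (φ : E →+* R) (U : Set R) (hU : IsOpen U) (h0 : (0 : R) ∈ U)
    (hiso : ∀ y : 𝓞 E, φ (algebraMap (𝓞 E) E y) ∈ U → y = 0) (Γ : Subgroup (GL (Fin 2) E))
    (hΓ : ∀ g ∈ Γ, IntegralEntries E (g : Matrix (Fin 2) (Fin 2) E)) :
    IsolatedOne (Γ.map (Matrix.GeneralLinearGroup.map φ)) := by
  let V : Set (GL (Fin 2) R) :=
    ⋂ i : Fin 2, ⋂ j : Fin 2, {h | (h : Matrix (Fin 2) (Fin 2) R) i j - (1 : Matrix (Fin 2) (Fin 2) R) i j ∈ U}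
  have hVopen : IsOpen V := by
    refine isOpen_iInter_of_finite fun i => isOpen_iInter_of_finite fun j => hU.preimage ?_
    exact (Units.continuous_val.matrix_elem i j).sub continuous_const
  have h1V : (1 : GL (Fin 2) R) ∈ V := by
    simp only [V, Set.mem_iInter, Set.mem_setOf_eq]
    intro i j
    simpa using h0
  refine ⟨V, hVopen.mem_nhds h1V, ?_⟩
  rintro γ ⟨g, hg, rfl⟩ hγV
  have hentry : ∀ i j, (g : Matrix (Fin 2) (Fin 2) E) i j = (1 : Matrix (Fin 2) (Fin 2) E) i j := by
    intro i j
    obtain ⟨y, hy⟩ := hΓ g hg i j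
    obtain ⟨d, hd⟩ := integralEntries_one E i j
    have hmem : φ (algebraMap (𝓞 E) E (y - d)) ∈ U := by
      have h := Set.mem_iInter.1 (Set.mem_iInter.1 hγV i) j
      simp only [Set.mem_setOf_eq] at h
      rw [map_sub, map_sub, hy, hd, map_one_apply]
      rw [Matrix.GeneralLinearGroup.map_apply] at h
      exact h
    have h1 := hiso _ hmem
    have h2 : algebraMap (𝓞 E) E y = algebraMap (𝓞 E) E d := by
      have h3 := congrArg (algebraMap (𝓞 E) E) h1
      rwa [map_sub, map_zero, sub_eq_zero] at h3
    rw [← hy, ← hd, h2]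
  have hg1 : g = 1 := Units.ext (Matrix.ext hentry)
  rw [hg1, map_one]

/-- **the general-field form**: `1` is isolated in the image of every integral subgroup of `GL₂(E)` in
`GL₂(E ⊗ ℝ) = GL (Fin 2) (mixedSpace E)` — any number field `E`. -/
theorem isolatedOne_map_mixed (Γ : Subgroup (GL (Fin 2) E))
    (hΓ : ∀ g ∈ Γ, IntegralEntries E (g : Matrix (Fin 2) (Fin 2) E)) :
    IsolatedOne (Γ.map (Matrix.GeneralLinearGroup.map (mixedEmbedding E))) := by
  obtain ⟨U, hU, h0, hiso⟩ := exists_isolating_open E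
  exact isolatedOne_map_of_isolating E (mixedEmbedding E) U hU h0 hiso Γ hΓ

/-! ## 4. Two helpers: subgroups inherit isolation; isolation transfers back through a continuous injective hom -/

section Helpers

variable {H H' : Type} [TopologicalSpace H] [Group H] [TopologicalSpace H'] [Group H']

omit E in
/-- a subgroup of a subgroup with `1` isolated has `1` isolated (the level subgroups `Γ_N ≤ GL₂(𝓞)`) -/
theorem isolatedOne_of_le {Γ Γ' : Subgroup H} (h : IsolatedOne Γ) (hle : Γ' ≤ Γ) : IsolatedOne Γ' := by
  obtain ⟨V, hV, hiso⟩ := h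
  exact ⟨V, hV, fun γ hγ hγV => hiso γ (hle hγ) hγV⟩

omit E in
/-- **transfer**: if `ι : H' →* H` is continuous and injective and `1` is isolated in `ι(Γ')`, then `1` is isolated in
`Γ'` (the inclusion `H₃ ↪ ∏_w GL₂(ℂ)` of the real archimedean group) -/
theorem isolatedOne_of_map (ι : H' →* H) (hι : Continuous ι) (hinj : Function.Injective ι)
    (Γ' : Subgroup H') (h : IsolatedOne (Γ'.map ι)) : IsolatedOne Γ' := by
  obtain ⟨V, hV, hiso⟩ := h
  refine ⟨ι ⁻¹' V, hι.continuousAt.preimage_mem_nhds (by rw [map_one]; exact hV), ?_⟩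
  intro γ hγ hγV
  have h1 : ι γ = 1 := hiso (ι γ) ⟨γ, hγ, rfl⟩ hγV
  exact hinj (h1.trans (map_one ι).symm)

omit E in
/-- **isolation is carried forward by an isomorphism with continuous inverse** (conjugation by a fixed element) -/
theorem isolatedOne_map_equiv (e : H' ≃* H) (he : Continuous e.symm) {Γ' : Subgroup H'}
    (h : IsolatedOne Γ') : IsolatedOne (Γ'.map e.toMonoidHom) := by
  obtain ⟨V, hV, hiso⟩ := h
  refine ⟨e.symm ⁻¹' V, he.continuousAt.preimage_mem_nhds (by rw [map_one]; exact hV), ?_⟩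
  rintro x ⟨γ, hγ, rfl⟩ hx
  have h1 : γ = 1 := hiso γ hγ (by simpa using hx)
  rw [h1, map_one]

end Helpers

/-! ## 5. The lattice-basis form: integral in the basis `P` (L1-p4's `hPint`) -/

/-- **`1` is isolated in the archimedean image of a subgroup that is integral in the basis `P`** — `P⁻¹ γ P` integral
for every `γ ∈ Γ` (the lattice datum's `hPint`): §3 on the conjugate subgroup `P⁻¹ Γ P`, carried back by conjugation
with `archEmb E P` (`isolatedOne_map_equiv`). -/
theorem isolatedOne_map_of_integral_conj (htc : ∀ w : InfinitePlace E, w.IsComplex)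
    (Γ : Subgroup (GL (Fin 2) E)) (P : GL (Fin 2) E)
    (hΓ : ∀ g ∈ Γ, IntegralEntries E ((P⁻¹ * g * P : GL (Fin 2) E) : Matrix (Fin 2) (Fin 2) E)) :
    IsolatedOne (Γ.map (archEmb E)) := by
  have h1 : IsolatedOne ((Γ.map (MulAut.conj P⁻¹).toMonoidHom).map (archEmb E)) := by
    apply isolatedOne_map_of_integral E htc
    rintro g' ⟨g, hg, rfl⟩
    simpa [MulAut.conj_apply] using hΓ g hg
  have hc : Continuous ⇑(MulAut.conj (archEmb E P)).symm := by
    have h : ⇑(MulAut.conj (archEmb E P)).symm = fun h => (archEmb E P)⁻¹ * h * archEmb E P := by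
      funext h
      exact MulAut.conj_symm_apply _ _
    rw [h]
    exact (continuous_const.mul continuous_id).mul continuous_const
  have h2 := isolatedOne_map_equiv (MulAut.conj (archEmb E P)) hc h1
  have h3 : ((Γ.map (MulAut.conj P⁻¹).toMonoidHom).map (archEmb E)).map
      (MulAut.conj (archEmb E P)).toMonoidHom = Γ.map (archEmb E) := by
    ext x
    simp only [Subgroup.mem_map, MulEquiv.coe_toMonoidHom, MulAut.conj_apply, exists_exists_and_eq_and]
    constructor
    · rintro ⟨g, hg, rfl⟩
      refine ⟨g, hg, ?_⟩
      simp only [map_mul, map_inv, inv_inv]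
      group
    · rintro ⟨g, hg, rfl⟩
      refine ⟨g, hg, ?_⟩
      simp only [map_mul, map_inv, inv_inv]
      group
  rw [h3] at h2
  exact h2

end

end Summit.Ventures.HodgeRepro2.Tier7.Line3.ArchimedeanDiscrete
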